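import Summits.AtomisticToContinuum.Crystallization.Theorems.AveragedTwelve.Negative.LoadBearing

/-!
# `AveragedTwelve` (crux stmt-AtomisticToContinuum-15806, route `SquareWellLayerCake`), negative side II:
# the ratio constant is tight to within 1.3 % — the statement FAILS at every ratio `c ≥ 2/√3`

(refuter, cdisprove seat, cycle 1; COMPUTATIONAL: two `native_decide` certificates over a 941-point
integer configuration; nothing is defined — statements are spelled out, the witness list enters the
proof as an explicit computable expression.)

Write `A(c)` for the crux with ratio constant `c` (the crux is `A(57/50)`, `57/50 = 1.14`):
`∀ N x G d ρ, 0 < d → ρ ≤ c·d → (G pairwise ≥ d apart) → Σ_{i∈G} #{j ∈ G, j ≠ i, dist ≤ ρ} ≤ 12·|G|`.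

`averagedTwelve_false_at_ratio_ge_bcc`: for every `c ≥ 2/√3 = 1.1547…`, `A(c)` is false.  Witness: the
ball `{p ∈ ℤ³ : p₀ ≡ p₁ ≡ p₂ (mod 2), |p|² ≤ 91}` of the body-centred cubic lattice `2ℤ³ ∪ (2ℤ³ + 𝟙)`
(941 points, nearest distance² 3, second distance² 4, ratio `2/√3`), with `d = √3`, `ρ = 2`: it has
11336 ordered pairs at distance ≤ 2 (8 + 6 = 14 per bulk point) against `12 · 941 = 11292`, fed to
`AveragedTwelveNegative.not_averagedTwelveAt_of_intConfig`.  So the crux's constant `57/50` sits 1.3 %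
below a ratio where the statement is false (bcc averages 14 there), and any proof must be sensitive to
the constant at that scale (`57/50 < 2/√3 ⇔ 3249·3 < 4·2500`, margin 0.0147).  This file does NOT
refute the crux.  All `[folklore]`.
-/

namespace Summit.AtomisticToContinuum.Crystallization.Theorems.AveragedTwelveNegative

open scoped BigOperators

/-- TIGHTNESS OF THE RATIO CONSTANT (computational, `native_decide`).  For every `c ≥ 2/√3 ≈ 1.1547`
the crux with ratio constant `c` is FALSE: the 941-point ball `|p|² ≤ 91` of the bcc lattice
`{p ∈ ℤ³ : p₀ ≡ p₁ ≡ p₂ (mod 2)}` (`d = √3`, `ρ = 2`) has 11336 > 12·941 ordered pairs at squared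
distance ≤ 4, i.e. averages ≈ 12.047 > 12 (14 in the bulk). [folklore] -/
theorem averagedTwelve_false_at_ratio_ge_bcc (c : ℝ) (hc : 2 / Real.sqrt 3 ≤ c) :
    ¬ (∀ (N : ℕ) (x : Fin N → EuclideanSpace ℝ (Fin 3)) (G : Finset (Fin N)) (d ρ : ℝ),
        0 < d → ρ ≤ c * d → (∀ i ∈ G, ∀ j ∈ G, i ≠ j → d ≤ dist (x i) (x j)) →
        (∑ i ∈ G, ((G.filter fun j => j ≠ i ∧ dist (x i) (x j) ≤ ρ).card : ℝ)) ≤ 12 * G.card) := by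
  -- the witness list, generalised so that the certificates below are stated over a variable
  obtain ⟨L, hL⟩ : ∃ L : List (Fin 3 → ℤ), L =
      (List.range 19).flatMap fun a => (List.range 19).flatMap fun b => (List.range 19).filterMap fun e =>
        if ((a : ℤ) - 9) % 2 = ((b : ℤ) - 9) % 2 ∧ ((b : ℤ) - 9) % 2 = ((e : ℤ) - 9) % 2 ∧
            ((a : ℤ) - 9) ^ 2 + ((b : ℤ) - 9) ^ 2 + ((e : ℤ) - 9) ^ 2 ≤ 91
        then some ![(a : ℤ) - 9, (b : ℤ) - 9, (e : ℤ) - 9] else none := ⟨_, rfl⟩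
  -- certificate 1: pairwise squared distances ≥ 3
  have hsep : ∀ i j : Fin L.length, i ≠ j →
      (3 : ℤ) ≤ (L[i] 0 - L[j] 0) ^ 2 + (L[i] 1 - L[j] 1) ^ 2 + (L[i] 2 - L[j] 2) ^ 2 := by
    subst hL
    native_decide
  -- certificate 2: more than 12·N ordered pairs at squared distance ≤ 4
  have hcount : 12 * L.length < ∑ i : Fin L.length, ((Finset.univ.filter fun j : Fin L.length => j ≠ i ∧
      (L[i] 0 - L[j] 0) ^ 2 + (L[i] 1 - L[j] 1) ^ 2 + (L[i] 2 - L[j] 2) ^ 2 ≤ (2 : ℤ) ^ 2).card) := by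
    subst hL
    native_decide
  have h3 : (0 : ℝ) < Real.sqrt 3 := Real.sqrt_pos.mpr (by norm_num)
  have hcM : ((2 : ℤ) : ℝ) ≤ c * Real.sqrt ((3 : ℤ) : ℝ) := by
    have : (2 : ℝ) ≤ c * Real.sqrt 3 := (div_le_iff₀ h3).mp hc
    exact_mod_cast this
  exact not_averagedTwelveAt_of_intConfig c (fun i : Fin L.length => L[i]) 3 2 (by norm_num) (by norm_num)
    hcM hsep hcount

/-- In particular the crux's statement is false at the bcc ratio `2/√3` itself (computational).
[folklore] -/
theorem averagedTwelve_false_at_bcc_ratio :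
    ¬ (∀ (N : ℕ) (x : Fin N → EuclideanSpace ℝ (Fin 3)) (G : Finset (Fin N)) (d ρ : ℝ),
        0 < d → ρ ≤ 2 / Real.sqrt 3 * d → (∀ i ∈ G, ∀ j ∈ G, i ≠ j → d ≤ dist (x i) (x j)) →
        (∑ i ∈ G, ((G.filter fun j => j ≠ i ∧ dist (x i) (x j) ≤ ρ).card : ℝ)) ≤ 12 * G.card) :=
  averagedTwelve_false_at_ratio_ge_bcc _ le_rfl

/-- Consequently no constant `c ≥ 2/√3` can replace `57/50` in `AveragedTwelve`: if the crux holds with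
constant `c` then `c < 2/√3` (computational). [folklore] -/
theorem ratio_lt_bcc_of_averagedTwelveAt (c : ℝ)
    (H : ∀ (N : ℕ) (x : Fin N → EuclideanSpace ℝ (Fin 3)) (G : Finset (Fin N)) (d ρ : ℝ),
        0 < d → ρ ≤ c * d → (∀ i ∈ G, ∀ j ∈ G, i ≠ j → d ≤ dist (x i) (x j)) →
        (∑ i ∈ G, ((G.filter fun j => j ≠ i ∧ dist (x i) (x j) ≤ ρ).card : ℝ)) ≤ 12 * G.card) :
    c < 2 / Real.sqrt 3 := by
  by_contra hc
  exact averagedTwelve_false_at_ratio_ge_bcc c (not_lt.mp hc) H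

end Summit.AtomisticToContinuum.Crystallization.Theorems.AveragedTwelveNegative
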